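import Summits.PneNP.PneNP.Theorems.PeaWorstToAvg.Negative.AdviceElimLoadBearing
import Summits.PneNP.PneNP.Theorems.SzkEntropyPeaWorstToAvgDualModeCompileDefs
import Literature.Computability.Complexity.PlumbingBricks
import Literature.Computability.Complexity.FoldBricks
import Literature.Computability.Complexity.BranchingFn
import Literature.Computability.Complexity.StackBricks

/-!
# PneNP / SzkEntropy — crux `PeaWorstToAvg` (stmt-PneNP-10777), negative side: the HONEST SAMPLER BUDGET
# hypothesis of the advice-elimination stub is load-bearing

Drefute content for the shared stub `stub_adviceElim` of the lines `orbit-pair-rsr` / `dual-mode-compile`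
(skeletons under `Cruxes/PeaWorstToAvg/Lines/`; uniform schemes `UHeurBPP` of
`SzkEntropyPeaWorstToAvgDualModeCompileDefs.lean`).  `AdviceElimLoadBearing.lean` (labels, samplability) and
`AdviceElimDisjointLoadBearing.lean` (disjointness) show three hypotheses necessary; here the fourth:

* `adviceElim_false_without_honestBudget` — `stub_adviceElim` WITHOUT `hc : ∀ b ℓ, (S b).coinLen ℓ = c.eval ℓ`
  (the samplers' common POLYNOMIAL coin budget), everything else verbatim (disjoint `Q`, polynomial-time samplers,
  certified `supp S false ⊆ Q.no`, `supp S true ⊆ Q.yes`, `HeurBPP`-membership, conclusion `∈ UHeurBPP`), is FALSE.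
  Witness family (`c : ℕ → Bool`): `a` interleaved (`a(3t)=1, a(3t+1)=0, a(3t+2)=c t`), `Q = ({x | a(size|x|)},
  {x | ¬a(size|x|)})`; both samplers run ONE polynomial-time select machine `(1ᵗ, r) ↦ 1^{(t+1)·2^{i}}`,
  `i = |r| ∈ {0,1,2}` (size classes `size(t+1) + i`, one per residue mod 3), and their coin COUNTS
  `coinLen_b(t) ∈ {0,1,2}` (advice, polynomially bounded but not a polynomial) route `S true` into a class with
  `a = 1` and `S false` into a class with `a = 0`, the `≡ 2 (mod 3)` class — whose bit is `c` — being served by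
  exactly one of them.  The mixture is `HeurBPP`-easy (`mem_HeurBPP_sizeClass`), and a uniform scheme at
  `(t, m) = (2^{3j+1} - 1, 4)` must answer `c j` on the atom `1^{2^{3j+1}}` (mass `≥ 1/2`): `c ↦ scheme` would
  inject `ℕ → Bool` into the countable uniform schemes.  MEANING: without `hc` the uniform simulator cannot draw
  its own labelled samples (it does not know how many coins to feed `S_b`); any proof must use `hc` there.

References: A. Bogdanov, L. Trevisan, *Average-Case Complexity*, FnT–TCS 2 (2006), Def. 2.1, 2.12–2.13;
S. Arora, B. Barak, *Computational Complexity* (2009), §6.3, Def. 7.1–7.3; R. Karp, R. Lipton (1982).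
-/

namespace Summit.PneNP.PneNP.Theorems

set_option linter.dupNamespace false -- `Summit.PneNP.PneNP.…`: summit = sub-problem name (D-0017)

open Literature.Computability.Complexity Literature.Computability.MetaComplexity
open Literature.Computability.Complexity.Brick
open _root_.Computability Polynomial
open Summit.PneNP.PneNP.Cruxes.PeaWorstToAvg.DualModeCompile (UHeurBPP)
open scoped ENNReal

/-! ### The select machine `(1ᵗ, r) ↦ 1^{(t+1)·2^{|r|}}`, `|r| ≤ 2` -/

/-- The three unary words served at parameter `t`: `1^{(t+1)·2^i}` (size class `size (t+1) + i`). [folklore] -/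
theorem size_length_selWord (t i : ℕ) :
    (unaryEncodeNat ((t + 1) * 2 ^ i)).length.size = (t + 1).size + i := by
  rw [show (unaryEncodeNat ((t + 1) * 2 ^ i)).length = (t + 1) * 2 ^ i from unary_decode_encode_nat _,
    ← Nat.shiftLeft_eq, Nat.size_shiftLeft (Nat.succ_ne_zero t)]

/-- **The select machine is an `FP` string function computing `(1ᵗ, r) ↦ 1^{(t+1)·2^{|r|}}` for `|r| ≤ 2`**
(branch on the parities of `|r|` and `|r|/2`; `iteFn`, `parityFn`, `lenBinF`, `polyFn`). [AroraBarakCC2009, §1.3] -/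
theorem selRun_polyTime :
    PolyTimeComputable (fun p : ℕ × List Bool => boolPair (unaryEncodeNat p.1) p.2) (id : List Bool → List Bool)
      (Function.uncurry fun (t : ℕ) (r : List Bool) =>
        if Even r.length then
          (if Even (r.length / 2) then unaryEncodeNat ((t + 1) * 2 ^ 0) else unaryEncodeNat ((t + 1) * 2 ^ 2))
        else unaryEncodeNat ((t + 1) * 2 ^ 1)) := by
  -- the branches and the two tests, as bricks
  let Y : ℕ → List Bool → List Bool := fun i => Plumb.polyFn ((X + 1) * C (2 ^ i)) ∘ fstF
  let C₀ : List Bool → List Bool := parityFn ∘ lenBinF ∘ sndF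
  let C₁ : List Bool → List Bool := parityFn ∘ Plumb.dropFn ∘ fanoutFn (fun _ => [true]) (lenBinF ∘ sndF)
  have hY : ∀ i, Y i ∈ FP := fun i => comp_mem_FP (Plumb.polyFn_mem_FP _) fstF_mem_FP
  have hC₀ : C₀ ∈ FP := comp_mem_FP parityFn_mem_FP (comp_mem_FP lenBinF_mem_FP sndF_mem_FP)
  have hC₁ : C₁ ∈ FP := comp_mem_FP parityFn_mem_FP (comp_mem_FP Plumb.dropFn_mem_FP
    (fanoutFn_mem_FP (const_mem_FP [true]) (comp_mem_FP lenBinF_mem_FP sndF_mem_FP)))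
  have hF : iteFn C₀ (iteFn C₁ (Y 0) (Y 2)) (Y 1) ∈ FP :=
    iteFn_mem_FP hC₀ (iteFn_mem_FP hC₁ (hY 0) (hY 2)) (hY 1)
  -- values on `⟨1ᵗ, r⟩`
  have hYval : ∀ i t r, Y i (boolPair (unaryEncodeNat t) r) = unaryEncodeNat ((t + 1) * 2 ^ i) := by
    intro i t r
    simp only [Y, Function.comp_apply, fstF_boolPair, Plumb.polyFn_apply, eval_mul, eval_add, eval_X, eval_one,
      eval_C, show (unaryEncodeNat t).length = t from unary_decode_encode_nat t]
    exact (OracleCompose.unaryEncodeNat_eq_replicate _).symm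
  have hC₀val : ∀ t r, C₀ (boolPair (unaryEncodeNat t) r) = [decide (Even r.length)] := by
    intro t r
    simp only [C₀, Function.comp_apply, sndF_boolPair, lenBinF_apply, Brick.parityFn, bitsToNat_encodeNat]
  have hC₁val : ∀ t r, C₁ (boolPair (unaryEncodeNat t) r) = [decide (Even (r.length / 2))] := by
    intro t r
    simp only [C₁, Function.comp_apply, fanoutFn_apply, sndF_boolPair, lenBinF_apply, Plumb.dropFn_boolPair,
      List.length_singleton, Brick.parityFn, Brick.bitsToNat_drop, bitsToNat_encodeNat, pow_one]
  refine PolyTimeComputable.of_encode_eq (f := iteFn C₀ (iteFn C₁ (Y 0) (Y 2)) (Y 1))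
    (fun p : ℕ × List Bool => boolPair (unaryEncodeNat p.1) p.2) (fun _ => rfl) (fun p => ?_) hF
  obtain ⟨t, r⟩ := p
  simp only [Function.uncurry, id]
  by_cases h0 : Even r.length
  · rw [iteFn_apply_true (by rw [hC₀val, decide_eq_true h0]), if_pos h0]
    by_cases h1 : Even (r.length / 2)
    · rw [iteFn_apply_true (by rw [hC₁val, decide_eq_true h1]), if_pos h1, hYval]
    · rw [iteFn_apply_false (by rw [hC₁val, decide_eq_false h1]), if_neg h1, hYval]
  · rw [iteFn_apply_false (by rw [hC₀val, decide_eq_false h0]), if_neg h0, hYval]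

/-! ### `stub_adviceElim` is FALSE without the honest sampler budget -/

/-- **`stub_adviceElim` WITHOUT `hc` (the samplers' common polynomial coin budget) is FALSE** — see the module
docstring for the witness family; all other hypotheses verbatim, conclusion `∈ UHeurBPP`.
[BogdanovTrevisan2006, Def. 2.1, 2.12–2.13; AroraBarakCC2009, §6.3; KarpLipton1982] -/
theorem adviceElim_false_without_honestBudget :
    ¬ ∀ (Q : PromiseProblem), Q.Disjoint → ∀ (S : Bool → RandAlg ℕ (List Bool)),
      (∀ b, (S b).IsPolyTime unaryEncodeNat (id : List Bool → List Bool)) →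
      (∀ n, ∀ w ∈ ((S false).outputPMF unaryEncodeNat n).support, w ∈ Q.no) →
      (∀ n, ∀ w ∈ ((S true).outputPMF unaryEncodeNat n).support, w ∈ Q.yes) →
      (⟨Q.yes, mixEnsemble (fun n => (S false).outputPMF unaryEncodeNat n)
          (fun n => (S true).outputPMF unaryEncodeNat n)⟩ : DistProblem) ∈ HeurBPP →
      (⟨Q.yes, mixEnsemble (fun n => (S false).outputPMF unaryEncodeNat n)
          (fun n => (S true).outputPMF unaryEncodeNat n)⟩ : DistProblem) ∈ UHeurBPP := by
  intro H
  -- the served words `y i t = 1^{(t+1)·2^i}` and the select run map (shared by both samplers)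
  let y : ℕ → ℕ → List Bool := fun i t => unaryEncodeNat ((t + 1) * 2 ^ i)
  let run : ℕ → List Bool → List Bool := fun t r =>
    if Even r.length then (if Even (r.length / 2) then y 0 t else y 2 t) else y 1 t
  have hrun : PolyTimeComputable (fun p : ℕ × List Bool => boolPair (unaryEncodeNat p.1) p.2)
      (id : List Bool → List Bool) (Function.uncurry run) := selRun_polyTime
  have hrunval : ∀ t r, r.length ≤ 2 → run t r = y r.length t := by
    intro t r hr
    obtain h | h | h : r.length = 0 ∨ r.length = 1 ∨ r.length = 2 := by omega
    · simp [run, h]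
    · simp [run, h]
    · simp only [run, h, even_two, if_true]
      rw [if_neg (by decide)]
  have hysize : ∀ i t, (y i t).length.size = (t + 1).size + i := fun i t => size_length_selWord t i
  -- index bookkeeping: at parameter `t` the three words have size classes `u, u+1, u+2`, `u = size (t+1)`;
  -- `idx j t` is the index of the word whose class is `≡ j (mod 3)`, `jdx t` the key position of the `≡ 2` class
  let u : ℕ → ℕ := fun t => (t + 1).size
  let idx : ℕ → ℕ → ℕ := fun j t => (j + 3 - u t % 3) % 3
  let jdx : ℕ → ℕ := fun t => (u t + idx 2 t - 2) / 3
  have hidx_le : ∀ j t, idx j t ≤ 2 := fun j t => Nat.le_of_lt_succ (Nat.mod_lt _ (by norm_num))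
  have hidx0 : ∀ t, ∃ q, u t + idx 0 t = 3 * q := fun t =>
    ⟨(u t + idx 0 t) / 3, by simp only [idx]; omega⟩
  have hidx1 : ∀ t, ∃ q, u t + idx 1 t = 3 * q + 1 := fun t =>
    ⟨(u t + idx 1 t) / 3, by simp only [idx]; omega⟩
  have hidx2 : ∀ t, u t + idx 2 t = 3 * jdx t + 2 := fun t => by
    simp only [jdx, idx]; omega
  -- for every key `c`, a uniform scheme from which `c` can be read off
  have key : ∀ c : ℕ → Bool, ∃ A : RandAlg (List Bool × ℕ × ℕ) Bool,
      (A.IsPolyTime schemeEnc encodeBool ∧ ∃ c : Polynomial ℕ, ∀ ℓ, A.coinLen ℓ = c.eval ℓ) ∧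
      ∀ j, decide ((1 : ℝ) / 2 <
        ((A.outputPMF schemeEnc (unaryEncodeNat (2 ^ (3 * j + 1)), 2 ^ (3 * j + 1) - 1, 4)) true).toReal) =
          c j := by
    intro c
    obtain ⟨a, ha0, ha1, ha2⟩ := interleave_spec c
    let L : Set (List Bool) := {x | a x.length.size = true}
    have hQ : (⟨L, Lᶜ⟩ : PromiseProblem).Disjoint := disjoint_compl_right
    -- the advice-carrying coin counts and the two samplers
    let cl : Bool → ℕ → ℕ := fun b t =>
      if b then (if c (jdx t) then idx 2 t else idx 0 t) else (if c (jdx t) then idx 1 t else idx 2 t)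
    have hcl_le : ∀ b t, cl b t ≤ 2 := by
      intro b t
      cases b <;> simp only [cl, if_true, Bool.false_eq_true, if_false] <;> split_ifs <;> exact hidx_le _ _
    let S : Bool → RandAlg ℕ (List Bool) := fun b => ⟨run, cl b⟩
    have hS : ∀ b, (S b).IsPolyTime unaryEncodeNat (id : List Bool → List Bool) := fun b =>
      ⟨hrun, 2, fun ℓ => by simpa using hcl_le b ℓ⟩
    -- the law of `S b` at `t` is the point mass on the selected word
    have hlaw : ∀ b t, (S b).outputPMF unaryEncodeNat t = PMF.pure (y (cl b t) t) := by
      intro b t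
      unfold RandAlg.outputPMF
      have hℓ : (unaryEncodeNat t).length = t := unary_decode_encode_nat t
      rw [show (fun r : List.Vector Bool ((S b).coinLen (unaryEncodeNat t).length) => (S b).run t r.toList) =
          fun _ => y (cl b t) t from ?_]
      · exact PMF.map_const _ _
      funext r
      have hr : r.toList.length = cl b t := by rw [List.Vector.toList_length]; simp [S, hℓ]
      show run t r.toList = y (cl b t) t
      rw [hrunval t r.toList (hr ▸ hcl_le b t), hr]
    -- certified sides
    have h₁ : ∀ t, ∀ w ∈ ((S true).outputPMF unaryEncodeNat t).support, w ∈ (⟨L, Lᶜ⟩ : PromiseProblem).yes := by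
      intro t w hw
      rw [hlaw, PMF.support_pure, Set.mem_singleton_iff] at hw
      subst hw
      show a (y (cl true t) t).length.size = true
      rw [hysize]
      simp only [cl, if_true]
      cases hc : c (jdx t)
      · simp only [Bool.false_eq_true, if_false]
        obtain ⟨q, hq⟩ := hidx0 t
        rw [show (t + 1).size + idx 0 t = 3 * q from hq]
        exact ha0 q
      · simp only [if_true]
        rw [show (t + 1).size + idx 2 t = 3 * jdx t + 2 from hidx2 t, ha2, hc]
    have h₀ : ∀ t, ∀ w ∈ ((S false).outputPMF unaryEncodeNat t).support, w ∈ (⟨L, Lᶜ⟩ : PromiseProblem).no := by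
      intro t w hw
      rw [hlaw, PMF.support_pure, Set.mem_singleton_iff] at hw
      subst hw
      show ¬ (a (y (cl false t) t).length.size = true)
      rw [hysize]
      simp only [cl, Bool.false_eq_true, if_false]
      cases hc : c (jdx t)
      · simp only [Bool.false_eq_true, if_false]
        rw [show (t + 1).size + idx 2 t = 3 * jdx t + 2 from hidx2 t, ha2, hc]
        exact Bool.false_ne_true
      · simp only [if_true]
        obtain ⟨q, hq⟩ := hidx1 t
        rw [show (t + 1).size + idx 1 t = 3 * q + 1 from hq, ha1]
        exact Bool.false_ne_true
    obtain ⟨A, hA, hAc, hbad⟩ := H ⟨L, Lᶜ⟩ hQ S hS h₀ h₁ (mem_HeurBPP_sizeClass a _)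
    refine ⟨A, ⟨hA, hAc⟩, fun j => ?_⟩
    -- the key parameter `t = 2^{3j+1} - 1`: `u t = 3j+2`, the `≡ 2` word is `y 0 t = 1^{2^{3j+1}}`, `jdx t = j`
    set t : ℕ := 2 ^ (3 * j + 1) - 1 with ht
    have ht1 : t + 1 = 2 ^ (3 * j + 1) := Nat.sub_add_cancel Nat.one_le_two_pow
    have hu : u t = 3 * j + 2 := by
      show (t + 1).size = 3 * j + 2
      rw [ht1, Nat.size_pow]
    have hidx2t : idx 2 t = 0 := by
      show (2 + 3 - u t % 3) % 3 = 0
      rw [hu]; omega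
    have hjdx : jdx t = j := by
      show (u t + idx 2 t - 2) / 3 = j
      rw [hidx2t, hu]; omega
    have hy0 : y 0 t = unaryEncodeNat (2 ^ (3 * j + 1)) := by
      show unaryEncodeNat ((t + 1) * 2 ^ 0) = _
      rw [ht1, pow_zero, mul_one]
    -- the atom `y 0 t` carries mixture mass `≥ 1/2`
    have hatom : (2 : ℝ≥0∞)⁻¹ ≤ (mixEnsemble (fun n => (S false).outputPMF unaryEncodeNat n)
        (fun n => (S true).outputPMF unaryEncodeNat n) t).toOuterMeasure {y 0 t} := by
      rw [toOuterMeasure_mixEnsemble]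
      cases hc : c j
      · have hcl : cl false t = 0 := by
          simp only [cl, Bool.false_eq_true, if_false, hjdx, hc, hidx2t]
        have : ((S false).outputPMF unaryEncodeNat t).toOuterMeasure {y 0 t} = 1 := by
          rw [hlaw, hcl, PMF.toOuterMeasure_pure_apply, if_pos (Set.mem_singleton _)]
        rw [this, mul_one]
        exact le_self_add
      · have hcl : cl true t = 0 := by
          simp only [cl, if_true, hjdx, hc, hidx2t]
        have : ((S true).outputPMF unaryEncodeNat t).toOuterMeasure {y 0 t} = 1 := by
          rw [hlaw, hcl, PMF.toOuterMeasure_pure_apply, if_pos (Set.mem_singleton _)]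
        rw [this, mul_one]
        exact le_add_self
    -- hence it is not bad at `m = 4`
    have hgood : A.pr schemeEnc (y 0 t, t, 4) {b | b ≠ L.boolIndicator (y 0 t)} < 1 / 4 := by
      by_contra hb
      push Not at hb
      have h4 := hbad t 4 (by norm_num)
      have hsub : {y 0 t} ⊆ {x | 1 / 4 ≤ A.pr schemeEnc (x, t, 4) {b | b ≠ L.boolIndicator x}} := by
        rintro _ rfl
        exact hb
      have hle : (2 : ℝ≥0∞)⁻¹ ≤ (mixEnsemble (fun n => (S false).outputPMF unaryEncodeNat n)
          (fun n => (S true).outputPMF unaryEncodeNat n) t).toOuterMeasure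
          {x | 1 / 4 ≤ A.pr schemeEnc (x, t, 4) {b | b ≠ L.boolIndicator x}} :=
        hatom.trans (PMF.toOuterMeasure_mono _ fun x hx => hsub hx.1)
      have hreal : (1 : ℝ) / 2 ≤ (mixEnsemble (fun n => (S false).outputPMF unaryEncodeNat n)
          (fun n => (S true).outputPMF unaryEncodeNat n)).prob t
          {x | 1 / 4 ≤ A.pr schemeEnc (x, t, 4) {b | b ≠ L.boolIndicator x}} := by
        rw [Ensemble.prob]
        have := ENNReal.toReal_mono (ne_top_of_le_ne_top ENNReal.one_ne_top
          (PMF.toOuterMeasure_mono _ (Set.subset_univ _) |>.trans_eq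
            ((PMF.toOuterMeasure_apply_eq_one_iff _ _).2 (Set.subset_univ _)))) hle
        simpa using this
      have h4' : (mixEnsemble (fun n => (S false).outputPMF unaryEncodeNat n)
          (fun n => (S true).outputPMF unaryEncodeNat n)).prob t
          {x | 1 / 4 ≤ A.pr schemeEnc (x, t, 4) {b | b ≠ L.boolIndicator x}} ≤ 1 / 4 := h4
      linarith
    -- read the key off
    have hmem : y 0 t ∈ L ↔ a (3 * j + 2) = true := by
      show a (y 0 t).length.size = true ↔ _
      rw [hysize, show (t + 1).size = u t from rfl, hu, add_zero]
    have hind : L.boolIndicator (y 0 t) = c j := by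
      cases h : c j
      · exact (Set.notMem_iff_boolIndicator _ _).1 (by rw [hmem, ha2, h]; exact Bool.false_ne_true)
      · exact (Set.mem_iff_boolIndicator _ _).1 (by rw [hmem, ha2, h])
    rw [hind, pr_ne_eq_toReal_apply_not] at hgood
    rw [← hy0]
    cases h : c j
    · rw [h] at hgood
      simp only [Bool.not_false] at hgood
      rw [decide_eq_false_iff_not, not_lt]
      linarith
    · rw [h] at hgood
      simp only [Bool.not_true] at hgood
      rw [decide_eq_true_iff, toReal_apply_true_eq]
      linarith
  -- countability contradiction
  choose A hA using key
  have hinj : Function.Injective A := fun c c' h => by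
    funext j
    rw [← (hA c).2 j, ← (hA c').2 j, h]
  exact false_of_injective_uniformSchemes A hinj fun c => (hA c).1

end Summit.PneNP.PneNP.Theorems
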